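import Mathlib
import Summits.ValiantsHypothesis.ValiantsHypothesis.Theses.ScaledPencil
import Literature.Computability.AlgebraicComplexity.PermanentIrreducible
import Literature.Computability.AlgebraicComplexity.DetReprEquivalent

/-!
# Route ScaledPencil — support item `MinimalRepStable` (stmt-ValiantsHypothesis-5321)

Route `route-ValiantsHypothesis-ScaledPencil`, item `stmt-ValiantsHypothesis-5321` (support;
the algebraic half of the normal form).

**Statement.** If `per_n` has no affine determinantal representation of size `< m`, then every
pencil `A = Λ + Σ_v x_v L_v` of size `m` with `det A = per_n` is θ-stable: every proper non-zero
subspace `U ⊂ ℂ^m` strictly expands, `dim U < dim (Λ U + Σ_v L_v U)`.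

**Proof.** Put `k = dim U` (`0 < k < m`) and `W = Λ U + Σ_v L_v U`, and suppose `dim W ≤ k`.
Choose a basis `b` of `ℂ^m` whose first `k` vectors span `U` and a basis `c` whose first
`dim W ≤ k` vectors span `W` (`exists_basis_adapted`).  With the (invertible, constant) change of
basis matrices `P` (columns `b j`) and `Q` (`c`-coordinates), every coefficient matrix
`M ∈ {Λ, L_v}` satisfies `(Q M P) i j = c.repr (M b_j) i = 0` for `i ≥ k > j`, so
`B = Q A P` is block upper triangular with square diagonal blocks `B₁₁` (`k × k`) and `B₂₂`
(`(m-k) × (m-k)`), affine entries, and `det B₁₁ · det B₂₂ = det B = det Q · det P · per_n`.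
Since `per_n` is irreducible (von zur Gathen 1987, Thm. 3.4; tree
`isUnit_or_isUnit_of_mul_eq_C_mul_perPoly`) one factor is a non-zero constant and the other is a
non-zero constant times `per_n`; rescaling one row gives an affine determinantal representation of
`per_n` of size `k < m` or `m - k < m`, contradicting minimality.  (For `n = 0`, `per_0 = 1` has
the empty representation, so minimality forces `m = 0` and there is no proper non-zero `U`.)
The case `dim W < dim U`, where `det A = 0`, needs no separate treatment: it is subsumed by the
same factorisation.

References: King 1994 (θ-stability of quiver representations); von zur Gathen 1987, Thm. 3.4.
-/

-- `Summit.<Summit>.<Problem>` repeats `ValiantsHypothesis` by the tree's layout convention (D-0017).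
set_option linter.dupNamespace false

namespace Summit.ValiantsHypothesis.ValiantsHypothesis.Theorems

open MvPolynomial Matrix
open Literature.Computability.AlgebraicComplexity

/-! ### Linear algebra: bases adapted to a subspace -/

/-- A basis of `ℂ^m` adapted to a subspace `U`: the first `dim U` basis vectors lie in `U`
(hence span it), so the coordinates of index `≥ dim U` of every vector of `U` vanish. -/
theorem exists_basis_adapted {m : ℕ} (U : Submodule ℂ (Fin m → ℂ)) :
    ∃ b : Module.Basis (Fin m) ℂ (Fin m → ℂ),
      (∀ j : Fin m, (j : ℕ) < Module.finrank ℂ U → b j ∈ U) ∧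
      ∀ u ∈ U, ∀ j : Fin m, Module.finrank ℂ U ≤ (j : ℕ) → b.repr u j = 0 := by
  classical
  obtain ⟨U', hUU'⟩ := U.exists_isCompl
  set l := Module.finrank ℂ U with hl_def
  have hlm : l ≤ m := (Submodule.finrank_le U).trans_eq (Module.finrank_fin_fun ℂ)
  have hU' : Module.finrank ℂ U' = m - l := by
    have h := Submodule.finrank_add_eq_of_isCompl hUU'
    rw [Module.finrank_fin_fun ℂ] at h
    omega
  let bU : Module.Basis (Fin l) ℂ U := Module.finBasisOfFinrankEq ℂ U rfl
  let bU' : Module.Basis (Fin (m - l)) ℂ U' := Module.finBasisOfFinrankEq ℂ U' hU'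
  set e : Fin l ⊕ Fin (m - l) ≃ Fin m :=
    finSumFinEquiv.trans (finCongr (Nat.add_sub_cancel' hlm)) with he_def
  let b₀ : Module.Basis (Fin l ⊕ Fin (m - l)) ℂ (Fin m → ℂ) :=
    (bU.prod bU').map (Submodule.prodEquivOfIsCompl U U' hUU')
  refine ⟨b₀.reindex e, fun j hj => ?_, fun u hu j hj => ?_⟩
  · have hej : e.symm j = Sum.inl ⟨j, hj⟩ := by
      rw [Equiv.symm_apply_eq]
      ext
      simp [he_def]
    rw [Module.Basis.reindex_apply, hej]
    simp [b₀, Module.Basis.prod_apply]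
  · have hej : e.symm j = Sum.inr ⟨j - l, by omega⟩ := by
      rw [Equiv.symm_apply_eq]
      ext
      simp [he_def]
      omega
    rw [Module.Basis.repr_reindex_apply, hej]
    simp only [b₀, Module.Basis.map_repr, LinearEquiv.trans_apply]
    rw [show (u : Fin m → ℂ) = ((⟨u, hu⟩ : U) : Fin m → ℂ) from rfl,
      Submodule.prodEquivOfIsCompl_symm_apply_left, Module.Basis.prod_repr_inr]
    simp

/-- Entries of a two-sided change of basis: with `P` the matrix whose columns are the vectors of a
basis `b` and `Q` the matrix of `c`-coordinates, `(Q M P) i j` is the `i`-th `c`-coordinate of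
`M b_j`. -/
theorem toMatrix_mul_mul_toMatrix_apply {m : ℕ} (b c : Module.Basis (Fin m) ℂ (Fin m → ℂ))
    (M : Matrix (Fin m) (Fin m) ℂ) (i j : Fin m) :
    (c.toMatrix (Pi.basisFun ℂ (Fin m)) * M * (Pi.basisFun ℂ (Fin m)).toMatrix b) i j =
      c.repr (M *ᵥ b j) i := by
  classical
  rw [Matrix.mul_assoc, basis_toMatrix_basisFun_mul, Matrix.of_apply]
  congr 2

/-! ### Determinantal representations: block factorisation and rescaling -/

/-- A block upper triangular matrix (zero lower-left block) has determinant the product of the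
determinants of its diagonal blocks. -/
theorem det_eq_of_toBlocks₂₁_eq_zero {R : Type*} [CommRing R] {p q : Type*} [Fintype p]
    [Fintype q] [DecidableEq p] [DecidableEq q] (M : Matrix (p ⊕ q) (p ⊕ q) R)
    (h : M.toBlocks₂₁ = 0) : M.det = M.toBlocks₁₁.det * M.toBlocks₂₂.det := by
  have := Matrix.det_fromBlocks_zero₂₁ M.toBlocks₁₁ M.toBlocks₁₂ M.toBlocks₂₂
  rwa [← h, Matrix.fromBlocks_toBlocks] at this

/-- Rescaling: if a square matrix of positive size with affine entries has determinant `c · f`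
with `c ≠ 0` a constant, then `f` has an affine determinantal representation of the same size
(divide one row by `c`). -/
theorem hasDetRepr_of_det_eq_C_mul {σ : Type*} {d : ℕ} (hd : 0 < d)
    {M : Matrix (Fin d) (Fin d) (MvPolynomial σ ℂ)} (hM : ∀ i j, (M i j).totalDegree ≤ 1)
    {c : ℂ} (hc : c ≠ 0) {f : MvPolynomial σ ℂ} (h : M.det = C c * f) : HasDetRepr f d := by
  classical
  set i₀ : Fin d := ⟨0, hd⟩
  refine ⟨M.updateRow i₀ ((C c⁻¹ : MvPolynomial σ ℂ) • M i₀), fun i j => ?_, ?_⟩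
  · rw [Matrix.updateRow_apply]
    split_ifs
    · rw [Pi.smul_apply, smul_eq_mul]
      exact (totalDegree_mul _ _).trans (by simpa using hM i₀ j)
    · exact hM i j
  · rw [Matrix.det_updateRow_smul, Matrix.updateRow_eq_self, h, ← mul_assoc, ← C_mul,
      inv_mul_cancel₀ hc, C_1, one_mul]

/-- `per_0 = 1` is the determinant of the empty matrix. -/
theorem hasDetRepr_perPoly_fin_zero : HasDetRepr (perPoly (Fin 0) ℂ) 0 :=
  ⟨1, fun i => Fin.elim0 i, by simp [perPoly, Matrix.permanent_isEmpty]⟩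

/-! ### The pencil under a constant change of bases -/

/-- Conjugating the pencil `Λ + Σ_v x_v L_v` by constant matrices conjugates its coefficients:
`Q (Λ + Σ_v x_v L_v) P = Q Λ P + Σ_v x_v (Q L_v P)`. -/
theorem map_C_mul_pencil_mul_map_C {n m : ℕ} (Q P Λ : Matrix (Fin m) (Fin m) ℂ)
    (L : Fin n × Fin n → Matrix (Fin m) (Fin m) ℂ) :
    Q.map C * (Matrix.of fun a b => C (Λ a b) + ∑ v : Fin n × Fin n, C (L v a b) * X v) * P.map C =
      Matrix.of fun a b => C ((Q * Λ * P) a b) +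
        ∑ v : Fin n × Fin n, C ((Q * L v * P) a b) * X v := by
  have h1 : (Matrix.of fun a b => C (Λ a b) + ∑ v : Fin n × Fin n, C (L v a b) * X v :
      Matrix (Fin m) (Fin m) (MvPolynomial (Fin n × Fin n) ℂ)) =
      Λ.map C + ∑ v, (X v : MvPolynomial (Fin n × Fin n) ℂ) • (L v).map C := by
    refine Matrix.ext fun a b => ?_
    simp only [Matrix.of_apply, Matrix.add_apply, Matrix.map_apply, Matrix.sum_apply,
      Matrix.smul_apply, smul_eq_mul]
    congr 1
    exact Finset.sum_congr rfl fun v _ => mul_comm _ _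
  have h2 : (Matrix.of fun a b => C ((Q * Λ * P) a b) +
      ∑ v : Fin n × Fin n, C ((Q * L v * P) a b) * X v :
      Matrix (Fin m) (Fin m) (MvPolynomial (Fin n × Fin n) ℂ)) =
      (Q * Λ * P).map C + ∑ v, (X v : MvPolynomial (Fin n × Fin n) ℂ) • (Q * L v * P).map C := by
    refine Matrix.ext fun a b => ?_
    simp only [Matrix.of_apply, Matrix.add_apply, Matrix.map_apply, Matrix.sum_apply,
      Matrix.smul_apply, smul_eq_mul]
    congr 1
    exact Finset.sum_congr rfl fun v _ => mul_comm _ _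
  rw [h1, h2, Matrix.mul_add, Matrix.add_mul, Finset.mul_sum, Finset.sum_mul]
  simp only [Matrix.map_mul, Matrix.mul_smul, Matrix.smul_mul]

/-- Entries of the pencil are affine. -/
theorem totalDegree_pencil_le {n m : ℕ} (Λ : Matrix (Fin m) (Fin m) ℂ)
    (L : Fin n × Fin n → Matrix (Fin m) (Fin m) ℂ) (a b : Fin m) :
    ((Matrix.of fun a b => C (Λ a b) + ∑ v : Fin n × Fin n, C (L v a b) * X v :
      Matrix (Fin m) (Fin m) (MvPolynomial (Fin n × Fin n) ℂ)) a b).totalDegree ≤ 1 := by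
  rw [Matrix.of_apply]
  refine (totalDegree_add _ _).trans (max_le (by simp) ?_)
  refine totalDegree_finsetSum_le fun v _ => (totalDegree_mul _ _).trans ?_
  simp

/-! ### The theorem -/

/-- **`MinimalRepStable`** (route ScaledPencil, stmt-ValiantsHypothesis-5321): at minimal size every
affine pencil computing `per_n` is θ-stable — every proper non-zero subspace `U ⊂ ℂ^m` satisfies
`dim U < dim (Λ U + Σ_v L_v U)`.  A non-expanding `U` block-triangularises the pencil after a
constant change of bases, `det` factors through the two diagonal blocks, and the irreducibility
of `per_n` (von zur Gathen 1987, Thm. 3.4) makes one block a unit, so the other block is a smaller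
affine determinantal representation of `per_n`. -/
theorem minimalRepStable_proof :
    Summit.ValiantsHypothesis.ValiantsHypothesis.Theses.ScaledPencil.MinimalRepStable := by
  unfold Summit.ValiantsHypothesis.ValiantsHypothesis.Theses.ScaledPencil.MinimalRepStable
  intro n m hmin Λ L hdet U hU0 hU1
  classical
  -- sizes
  set k := Module.finrank ℂ U with hk_def
  have hk0 : 0 < k := Nat.pos_of_ne_zero fun h => hU0 (Submodule.finrank_eq_zero.mp h)
  have hkm' : k ≤ m := (Submodule.finrank_le U).trans_eq (Module.finrank_fin_fun ℂ)
  have hkm : k < m := lt_of_le_of_ne hkm' fun h =>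
    hU1 (Submodule.eq_top_of_finrank_eq (h.trans (Module.finrank_fin_fun ℂ).symm))
  -- `n = 0`: `per_0 = 1` has the empty representation, contradicting minimality at `m > 0`
  rcases Nat.eq_zero_or_pos n with rfl | hn
  · exact absurd hasDetRepr_perPoly_fin_zero (hmin 0 (by omega))
  haveI : Nonempty (Fin n) := ⟨⟨0, hn⟩⟩
  -- the expansion `W` and the contradiction hypothesis `dim W ≤ k`
  set W : Submodule ℂ (Fin m → ℂ) :=
    U.map (Matrix.toLin' Λ) ⊔ ⨆ v, U.map (Matrix.toLin' (L v)) with hW_def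
  by_contra hlt
  have hWk : Module.finrank ℂ W ≤ k := not_lt.mp hlt
  have hΛW : ∀ u ∈ U, Λ *ᵥ u ∈ W := fun u hu =>
    Submodule.mem_sup_left (Submodule.mem_map_of_mem (f := Matrix.toLin' Λ) hu)
  have hLW : ∀ v, ∀ u ∈ U, L v *ᵥ u ∈ W := fun v u hu =>
    Submodule.mem_sup_right
      (Submodule.mem_iSup_of_mem v (Submodule.mem_map_of_mem (f := Matrix.toLin' (L v)) hu))
  -- adapted bases and the constant change of bases
  obtain ⟨b, hbU, -⟩ := exists_basis_adapted U
  obtain ⟨c, -, hcW⟩ := exists_basis_adapted W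
  set P : Matrix (Fin m) (Fin m) ℂ := (Pi.basisFun ℂ (Fin m)).toMatrix b with hP_def
  set Q : Matrix (Fin m) (Fin m) ℂ := c.toMatrix (Pi.basisFun ℂ (Fin m)) with hQ_def
  have hP : P.det ≠ 0 := by
    have h := congrArg Matrix.det
      ((Pi.basisFun ℂ (Fin m)).toMatrix_mul_toMatrix_flip b)
    rw [Matrix.det_mul, Matrix.det_one] at h
    exact left_ne_zero_of_mul_eq_one h
  have hQ : Q.det ≠ 0 := by
    have h := congrArg Matrix.det (c.toMatrix_mul_toMatrix_flip (Pi.basisFun ℂ (Fin m)))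
    rw [Matrix.det_mul, Matrix.det_one] at h
    exact left_ne_zero_of_mul_eq_one h
  -- the zero pattern of the conjugated coefficient matrices
  have hzero : ∀ M : Matrix (Fin m) (Fin m) ℂ, (∀ u ∈ U, M *ᵥ u ∈ W) →
      ∀ i j : Fin m, k ≤ (i : ℕ) → (j : ℕ) < k → (Q * M * P) i j = 0 := by
    intro M hM i j hi hj
    rw [hQ_def, hP_def, toMatrix_mul_mul_toMatrix_apply]
    exact hcW _ (hM _ (hbU j hj)) i (hWk.trans hi)
  -- the conjugated pencil `B = Q A P`
  set A : Matrix (Fin m) (Fin m) (MvPolynomial (Fin n × Fin n) ℂ) :=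
    Matrix.of fun a b => C (Λ a b) + ∑ v : Fin n × Fin n, C (L v a b) * X v with hA_def
  set B : Matrix (Fin m) (Fin m) (MvPolynomial (Fin n × Fin n) ℂ) :=
    Q.map C * A * P.map C with hB_def
  have hBdeg : ∀ i j, (B i j).totalDegree ≤ 1 :=
    totalDegree_map_C_mul_mul_map_C_le Q P (totalDegree_pencil_le Λ L)
  have hBdet : B.det = C (Q.det * P.det) * perPoly (Fin n) ℂ := by
    rw [hB_def, det_map_C_mul_mul_map_C, hdet]
  have hBapply : ∀ i j, B i j = C ((Q * Λ * P) i j) +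
      ∑ v : Fin n × Fin n, C ((Q * L v * P) i j) * X v := by
    intro i j
    have h := map_C_mul_pencil_mul_map_C Q P Λ L
    rw [← hA_def, ← hB_def] at h
    rw [h, Matrix.of_apply]
  have hBzero : ∀ i j : Fin m, k ≤ (i : ℕ) → (j : ℕ) < k → B i j = 0 := by
    intro i j hi hj
    rw [hBapply, hzero Λ hΛW i j hi hj, Finset.sum_eq_zero fun v _ => ?_]
    · simp
    · rw [hzero (L v) (hLW v) i j hi hj, C_0, zero_mul]
  -- reindex by `Fin k ⊕ Fin (m - k)` and factor the determinant
  set e : Fin k ⊕ Fin (m - k) ≃ Fin m :=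
    finSumFinEquiv.trans (finCongr (Nat.add_sub_cancel' hkm')) with he_def
  set B' : Matrix (Fin k ⊕ Fin (m - k)) (Fin k ⊕ Fin (m - k)) (MvPolynomial (Fin n × Fin n) ℂ) :=
    B.submatrix e e with hB'_def
  have he_inl : ∀ j : Fin k, ((e (Sum.inl j) : Fin m) : ℕ) = j := fun j => by simp [he_def]
  have he_inr : ∀ i : Fin (m - k), ((e (Sum.inr i) : Fin m) : ℕ) = k + i := fun i => by
    simp [he_def]
  have h21 : B'.toBlocks₂₁ = 0 := by
    refine Matrix.ext fun i j => ?_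
    simp only [Matrix.toBlocks₂₁, Matrix.of_apply, hB'_def, Matrix.submatrix_apply,
      Matrix.zero_apply]
    refine hBzero (e (Sum.inr i)) (e (Sum.inl j)) ?_ ?_
    · rw [he_inr]; omega
    · rw [he_inl]; exact j.isLt
  have hfactor : B'.toBlocks₁₁.det * B'.toBlocks₂₂.det = C (Q.det * P.det) * perPoly (Fin n) ℂ := by
    rw [← det_eq_of_toBlocks₂₁_eq_zero B' h21, hB'_def, Matrix.det_submatrix_equiv_self, hBdet]
  have hc0 : Q.det * P.det ≠ 0 := mul_ne_zero hQ hP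
  have hdeg₁₁ : ∀ i j, (B'.toBlocks₁₁ i j).totalDegree ≤ 1 := fun i j => hBdeg _ _
  have hdeg₂₂ : ∀ i j, (B'.toBlocks₂₂ i j).totalDegree ≤ 1 := fun i j => hBdeg _ _
  -- irreducibility of `per_n`: one diagonal block has a unit determinant
  rcases isUnit_or_isUnit_of_mul_eq_C_mul_perPoly hc0 hfactor with h₁ | h₂
  · -- `det B₁₁` is a unit: `B₂₂` is (up to a constant) a representation of size `m - k < m`
    obtain ⟨r, hr, hr₁⟩ := MvPolynomial.isUnit_iff_eq_C_of_isReduced.mp h₁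
    have hr0 : r ≠ 0 := hr.ne_zero
    have h₂₂ : B'.toBlocks₂₂.det = C (r⁻¹ * (Q.det * P.det)) * perPoly (Fin n) ℂ := by
      calc B'.toBlocks₂₂.det = C r⁻¹ * (B'.toBlocks₁₁.det * B'.toBlocks₂₂.det) := by
            rw [hr₁, ← mul_assoc, ← C_mul, inv_mul_cancel₀ hr0, C_1, one_mul]
        _ = C (r⁻¹ * (Q.det * P.det)) * perPoly (Fin n) ℂ := by
            rw [hfactor, ← mul_assoc, ← C_mul]
    exact hmin (m - k) (by omega)
      (hasDetRepr_of_det_eq_C_mul (by omega) hdeg₂₂ (mul_ne_zero (inv_ne_zero hr0) hc0) h₂₂)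
  · -- `det B₂₂` is a unit: `B₁₁` is (up to a constant) a representation of size `k < m`
    obtain ⟨r, hr, hr₂⟩ := MvPolynomial.isUnit_iff_eq_C_of_isReduced.mp h₂
    have hr0 : r ≠ 0 := hr.ne_zero
    have h₁₁ : B'.toBlocks₁₁.det = C (r⁻¹ * (Q.det * P.det)) * perPoly (Fin n) ℂ := by
      calc B'.toBlocks₁₁.det = C r⁻¹ * (B'.toBlocks₁₁.det * B'.toBlocks₂₂.det) := by
            rw [hr₂, mul_comm (B'.toBlocks₁₁.det), ← mul_assoc, ← C_mul, inv_mul_cancel₀ hr0,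
              C_1, one_mul]
        _ = C (r⁻¹ * (Q.det * P.det)) * perPoly (Fin n) ℂ := by
            rw [hfactor, ← mul_assoc, ← C_mul]
    exact hmin k hkm
      (hasDetRepr_of_det_eq_C_mul hk0 hdeg₁₁ (mul_ne_zero (inv_ne_zero hr0) hc0) h₁₁)

end Summit.ValiantsHypothesis.ValiantsHypothesis.Theorems
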